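import Literature.AnabelianGeometry.EtaleTheta.BiKummerThm44FaithfulSlotOneComp
import Literature.AnabelianGeometry.EtaleTheta.Discharge.Sec4Prop42SubHullClauses
import HarnessLib

/-!
# [FrdII] Def 2.2 (i) at abc-iut-w6-d048's one-component tempered Frobenioid: conjugation is TRIVIAL on `O^×(A)`, so the TRIVIAL
# descended action is LAWFUL — the action datum of the faithful slot is INHABITED at constructed data (proof-only)

S. Mochizuki, *The geometry of Frobenioids II* [MochizukiFrdII2008], Def 2.2 (i) p.17 («the natural action by conjugation of `Aut_C(A)` on
`O^×(A)` factors through `G_A`»); [MochizukiFrdI2008] Thm 5.2 (i) p.100 (composition law of the model Frobenioid); [MochizukiEtTh2009]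
Def 3.3 (iii) p.73, Rmk 3.3.1 (functions on a connected covering under the trivial action are constant).

abc-iut-w6-d047 (gen 3).  Closes the honest-scope item of `BiKummerThm44FaithfulSlotOneComp` (p470195): at abc-iut-w6-d048's model
`OneCompTempered.temperedFrobenioid U hU X R S` (trivial Galois action on the one-component log-divisor model, base `B^temp(Π^tp_X)⁰`)
* `OneCompTempered.B₀_map_endo_apply` — endomorphisms of a coset object pull `B₀ = Hom_Π(Π/H, Mero)` back IDENTICALLY (equivariant maps
  out of one orbit into a trivially acted-on target are constant);
* `OneCompTempered.pull_ratFnFunctor_endo` — hence endomorphisms of the base pull `B(A) = B₀ ×_{Φ^gp} Φ^gp` back identically;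
* `OneCompTempered.conj_eq_of_mem_units` — **`α u α⁻¹ = u` for every `α ∈ Aut_C(A)`, `u ∈ O^×(A)`** ([FrdI] Thm 5.2 (i) composition law via
  abc-iut-w4-d044's `ModelFrobenioid.conj_eq_self_of_pull_unit_eq`);
* `OneCompTempered.exists_lawful_act` — **there IS a lawful descended action datum** (`act` with the law `hact` of `def22Ctx`): the TRIVIAL
  action of `Aut_E(A_E)` on `O^×(A)`.  With p470195: at constructed data the faithful-slot Thm 4.4 closers have ALL data inhabited and fire
  ⟸ {`haug`, `hΔ`}.
PROOF-ONLY (0 definitions).  Constructed ≠ endorsed; nothing here bears on [IUTchIII] Cor 3.12.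
-/

noncomputable section

namespace Literature.AnabelianGeometry.EtaleTheta

open CategoryTheory Opposite Function Literature.AlgebraicGeometry.Frobenioids Literature.AnabelianGeometry.SemiGraphs

namespace OneCompTempered

variable (U : Type) [CommGroup U] (hU : ∀ u : U, (∀ N : ℕ+, ∃ g : U, g ^ (N : ℕ) = u) → u = 1)
  {K : Type} [Field K] (X : SemiGraphs.TemperedArithmeticGroup.{0} K)
  (R S : ((ConnectedPart (BTemp X.Pi))ᵒᵖ ⥤ CommMonCat.{0}) → Prop)

/-- **Endomorphisms of a coset object pull `B₀` back identically** (every `Π`-equivariant function on ONE orbit with values in a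
trivially acted-on target is constant). [cite: MochizukiEtTh2009, Rmk 3.3.1 p.73] -/
theorem B₀_map_endo_apply (Y : CosetCat X.Pi) (g : Y ⟶ Y) (b : (dm U hU X).B₀.obj (op Y)) :
    ((dm U hU X).B₀.map g.op).hom b = b := by
  have hS := isConnectedGSet_toBTemp X Y
  have key : ∀ t t' : ((CosetCat.toBTemp X.isTempered).obj Y).obj.V, b.1 t = b.1 t' := fun t t' => by
    obtain ⟨γ, hγ⟩ := hS.2 t' t
    rw [← hγ]
    exact b.2.2 γ t'
  exact Subtype.ext (funext fun s => key _ _)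

/-- **Endomorphisms of the base pull `B(A)` back identically** (`B₀`-component: `B₀_map_endo_apply`; `Φ`-component: abc-iut-w6-d048's
`phiZeroPull_endo_apply` through the perfection/realification image). [cite: MochizukiEtTh2009, Def 3.6 p.77] -/
theorem pull_ratFnFunctor_endo (A : ConnectedPart (BTemp X.Pi)) (φ : A ⟶ A)
    (w : (temperedFrobenioid U hU X R S).ratFnFunctor.obj (op A)) :
    pull (temperedFrobenioid U hU X R S).ratFnFunctor φ w = w := by
  have hΦ : ∀ x : (temperedFrobenioid U hU X R S).Φ.carrier (op A), (temperedFrobenioid U hU X R S).Φ.pull φ.op x = x :=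
    fun x => (rankOneBase U hU X).Φsub_pull_apply_of_trivial (hpf U hU X) φ.op (fun m =>
      OneCompTrivFrd.phiZeroPull_endo_apply U hU X.Pi (isConnectedGSet_toBTemp X ((equiv X).inverse.obj A)) _ m) x
  have hid : (temperedFrobenioid U hU X R S).Φ.pull φ.op = MonoidHom.id _ := MonoidHom.ext hΦ
  change (temperedFrobenioid U hU X R S).ratFnPull φ.op w = w
  apply Subtype.ext
  rw [TemperedFrobenioid.coe_ratFnPull, hid]
  refine Prod.ext ?_ ?_
  · exact B₀_map_endo_apply U hU X ((equiv X).inverse.obj A) ((equiv X).inverse.map φ) w.1.1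
  · exact DFunLike.congr_fun (Literature.AlgebraicGeometry.Frobenioids.gpMap_id (M := _)) w.1.2

/-- **Conjugation is TRIVIAL on `O^×(A)`** at the model: `α u α⁻¹ = u` for all `α ∈ Aut_C(A)`, `u ∈ O^×(A)` ([FrdI] Thm 5.2 (i):
`u_{α⁻¹uα} = Base(α⁻¹)^* u_u = u_u`, `Div u = 0`). [cite: MochizukiFrdI2008, Thm. 5.2 (i) p.100] -/
theorem conj_eq_of_mem_units (A : (temperedFrobenioid U hU X R S).category) (α : Aut A)
    (u : ↥((temperedFrobenioid U hU X R S).units A)) : α * u.1 * α⁻¹ = u.1 := by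
  have hu : u.1 ∈ ModelFrobenioid.units A := by
    rw [← (temperedFrobenioid U hU X R S).unitsSubgroup_toElem_eq_units]; exact u.2
  exact ModelFrobenioid.conj_eq_self_of_pull_unit_eq
    (PfImageWeak.isDivisorial_mrange_toRealification (hpf U hU X _)).isSharp hu α
    (pull_ratFnFunctor_endo U hU X R S A.base _ _)

/-- **A LAWFUL descended action datum EXISTS at the model**: the trivial action of `Aut_E(A_E)` on `O^×(A)` satisfies the law `hact` of
`def22Ctx` (conjugation is trivial). Hence the faithful-slot Thm 4.4 closers of p470195 have every datum inhabited at constructed data.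
[cite: MochizukiFrdII2008, Def 2.2 (i) p.17] -/
theorem exists_lawful_act (haug : IsOpenMap X.aug) (A : (temperedFrobenioid U hU X R S).category) :
    ∃ act : MulDistribMulAction (Aut (TemperedFrobenioid.AE X (temperedFrobenioid U hU X R S) haug A))
        ↥((temperedFrobenioid U hU X R S).units A),
      ∀ (α : Aut A) (u : ↥((temperedFrobenioid U hU X R S).units A)),
        (letI := act; (TemperedFrobenioid.resE X (temperedFrobenioid U hU X R S) haug A α) • u) =
          (⟨α * u.1 * α⁻¹, ((temperedFrobenioid U hU X R S).units_normal A).conj_mem _ u.2 α⟩ :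
            ↥((temperedFrobenioid U hU X R S).units A)) := by
  refine ⟨{ smul := fun _ u => u
            one_smul := fun _ => rfl
            mul_smul := fun _ _ _ => rfl
            smul_mul := fun _ _ _ => rfl
            smul_one := fun _ => rfl }, fun α u => Subtype.ext ?_⟩
  exact (conj_eq_of_mem_units U hU X R S A α u).symm

end OneCompTempered

end Literature.AnabelianGeometry.EtaleTheta

end
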